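import Literature.NumberTheory.LFunctions.Polymath15ErrorMajorantsSharp
import HarnessLib

/-!
# Polymath 15, Theorem 1.3 from Proposition 6.2 (the combination step)

Topic `Literature/NumberTheory/LFunctions` — the last item (**E4**) of the typed decomposition of the
printed proof of Polymath 15, Thm. 1.3 (`Polymath15.effective_approximation`, a named fact of
`Polymath15EffectiveApproximation.lean`). Inputs, all in this topic:

* E0 `heat_rs_expansion` (`Polymath15HeatRSExpansion.lean`, §4 eq. (htz-expand)):
  `H_t(z) = Σ_{n≤N} (r_{t,n}(s₋) + r*_{t,n}(s₊)) + R_{t,N}(s₋) + R*_{t,N}(s₊)`, `s_∓ = (1 ∓ y ± ix)/2`;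
* E1 `rtn_estimate` (`Polymath15RtnEstimate.lean`, Prop. 6.1): `r_{t,n} = r-main_{t,n}(1 + O_≤(ε_{t,n}))`;
* E3♯ `RtN_bound_sharp` (`Polymath15RtNBound.lean`, Prop. 6.3 with corrected constants, from the
  named fact `arias_lehmer_rs_bound` = Arias de Reyna 2011 = the source's Prop. 6.2, item E2):
  `|R_{t,N}(σ+iT)| ≤ e^{tπ²/64}|M₀(iT')|(1/2 + ε̃♯)`;
* E4a `eA_add_eB_le_errAB` (`Polymath15ErrorMajorants.lean`, Prop. 6.6 (iv)–(v)) and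
  E4a♯ `eC0Sharp_le_errC0` (`Polymath15ErrorMajorantsSharp.lean`, Prop. 6.6 (vi) for `ε̃♯`).

Following §6.3 of the source (Cors. 6.4–6.5 and the division by `B_t`; "noting that `M_t = M_t^*`
and `α = α^*`"): `B_t f_t = A_{t,N} + B_{t,N}` exactly (`Bt_mul_ft`: the first sum of `f_t` is
`Σ (r-main_{t,n})^*(s₊)/B_t`, the second is `Σ r-main_{t,n}(s₋)/B_t` via the identity
`conj(s_*) + κ = s₋ + y + (t/2)α(s₋)`), the moduli `|r-main_{t,n}(s₋)|/|B_t|` and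
`|r-main_{t,n}(s̄₊)|/|B_t|` are the weights of `e_A`, `e_B` (`norm_rtMain_sMinus`,
`norm_rtMain_sPlusBar`), and the two remainders give `|B_t| e♯_{C,0}`; hence
(`norm_deBruijnH_sub_Bt_mul_ft_le`) `|H_t − B_t f_t| ≤ |B_t|(e_A + e_B + e♯_{C,0})` and

  `theorem effective_approximation_of_arias (hA : arias_lehmer_rs_bound) : effective_approximation`.

So Thm. 1.3 as vendored is proved modulo the single named fact `arias_lehmer_rs_bound` (E2); no new
named fact is introduced. (The printed constant `0.397` of Prop. 6.3 is replaced throughout by the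
honest `ε̃♯`, see `Polymath15RtNBound.lean`; the printed majorants `errAB`, `errC0` of Thm. 1.3 are
unchanged.)

## References

* D. H. J. Polymath, *Effective approximation of heat flow evolution of the Riemann ξ function, and
  a new upper bound for the de Bruijn–Newman constant*, Res. Math. Sci. 6 (2019), Paper 31,
  arXiv:1904.12438: Thm. 1.3, §4 eq. (htz-expand), §6.3 (Cors. 6.4, 6.5, eqs. (ea-def)–(ec0-def),
  Prop. 6.6). [Polymath2019]
* J. Arias de Reyna, *High precision computation of Riemann's zeta function by the Riemann–Siegel
  formula, I*, Math. Comp. 80 (2011), 995–1009 (the input named fact, via E3♯). [AriasDeReyna2011]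
-/

noncomputable section

open Complex MeasureTheory Set Filter Topology

open scoped Real

namespace Literature.NumberTheory.LFunctions

namespace Polymath15

/-! ## E4: the combination — Thm. 1.3 from E0, E1, E3♯, E4a, E4a♯ (modulo E2) -/

section Combination

open scoped ComplexConjugate

variable {t x y : ℝ}

/-- `conj s₊ = (1 + y + ix)/2 = s̄₊`. [cite: Polymath2019, Cor. 6.4] -/
theorem conj_sPlus (x y : ℝ) : conj (sPlus x y) = (1 + y + x * I) / 2 := by
  rw [sPlus]
  simp only [map_div₀, map_add, map_sub, map_mul, map_one, Complex.conj_ofReal, Complex.conj_I,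
    map_ofNat]
  ring

/-- `s₋ = (1−y)/2 + i x/2`. [cite: Polymath2019, Cor. 6.4] -/
theorem sMinus_eq (x y : ℝ) : sMinus x y = (((1 - y) / 2 : ℝ) : ℂ) + ((x / 2 : ℝ) : ℂ) * I := by
  rw [sMinus]; push_cast; ring

/-- `s̄₊ = (1+y)/2 + i x/2`. [cite: Polymath2019, Cor. 6.4] -/
theorem sPlusBar_eq (x y : ℝ) :
    ((1 + y + x * I) / 2 : ℂ) = (((1 + y) / 2 : ℝ) : ℂ) + ((x / 2 : ℝ) : ℂ) * I := by
  push_cast; ring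

/-- `(1 + i z)/2 = s₋` for `z = x + iy`. [cite: Polymath2019, §6.3, proof of Cor. 6.4] -/
theorem half_one_add_I_mul (x y : ℝ) : (1 + I * ((x : ℂ) + y * I)) / 2 = sMinus x y := by
  rw [sMinus]; linear_combination ((y : ℂ) / 2) * Complex.I_sq

/-- `(1 − i z)/2 = s₊` for `z = x + iy`. [cite: Polymath2019, §6.3, proof of Cor. 6.4] -/
theorem half_one_sub_I_mul (x y : ℝ) : (1 - I * ((x : ℂ) + y * I)) / 2 = sPlus x y := by
  rw [sPlus]; linear_combination (-(y : ℂ) / 2) * Complex.I_sq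

/-- `Im s₊ = −x/2`. [folklore] -/
private theorem sPlus_im (x y : ℝ) : (sPlus x y).im = -x / 2 := by simp [sPlus]

/-- `conj (n^w) = n^{conj w}` for `n ∈ ℕ`. [folklore] -/
private theorem conj_natCast_cpow (n : ℕ) (w : ℂ) : conj ((n : ℂ) ^ w) = (n : ℂ) ^ conj w := by
  have h := Complex.conj_cpow (n : ℂ) (conj w)
    (by rw [Complex.natCast_arg]; exact Real.pi_ne_zero.symm)
  rw [Complex.conj_conj, Complex.conj_natCast] at h
  exact h.symm

/-- `conj(s_*) + κ = s₋ + y + (t/2) α(s₋)` (`α = α^*`), the identity behind the second sum of `f_t`.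
[cite: Polymath2019, §6.3, eq. (ft-def) from Cor. 6.5] -/
theorem conj_sStar_add_kappa (t : ℝ) {x : ℝ} (hx : x ≠ 0) (y : ℝ) :
    conj (sStar t x y) + kappa t x y = sMinus x y + y + t / 2 * alpha (sMinus x y) := by
  have hs : (sPlus x y).im ≠ 0 := by rw [sPlus_im]; intro h; apply hx; linarith
  have hα : conj (alpha (sPlus x y)) = alpha ((1 + y + x * I) / 2) := by
    rw [← conj_sPlus, alpha_conj hs]
  rw [sStar, kappa, map_add, map_mul, hα, conj_sPlus, map_div₀, Complex.conj_ofReal, map_ofNat,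
    sMinus]
  ring

/-- `(r^t_{n}-main)^*(s₊) = B_t b_n^t n^{−s_*}` (`M_t = M_t^*`, `α = α^*`).
[cite: Polymath2019, §6.3, B_{t,N} in Cor. 6.4] -/
theorem refl_rtMain_sPlus (t : ℝ) {x : ℝ} (hx : x ≠ 0) (y : ℝ) (n : ℕ) :
    refl (rtMain t n) (sPlus x y) = Bt t x y * (bCoeff t n : ℂ) * (n : ℂ) ^ (-sStar t x y) := by
  have hs : (sPlus x y).im ≠ 0 := by rw [sPlus_im]; intro h; apply hx; linarith
  have hM : conj (Mt t (conj (sPlus x y))) = Mt t (sPlus x y) := by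
    rw [Mt_conj t hs, Complex.conj_conj]
  have hw : conj (-(conj (sPlus x y) + t / 2 * alpha (conj (sPlus x y)))) = -sStar t x y := by
    rw [alpha_conj hs, sStar]
    simp only [map_neg, map_add, map_mul, map_div₀, Complex.conj_conj, Complex.conj_ofReal,
      map_ofNat]
  rw [refl, rtMain, map_mul, map_mul, hM, Complex.conj_ofReal, conj_natCast_cpow, hw, Bt]

/-- `r^t_{n}-main(s₋) = M_t(s₋) b_n^t n^y n^{−(conj s_* + κ)}`.
[cite: Polymath2019, §6.3, A_{t,N} in Cor. 6.4 and eq. (ft-def)] -/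
theorem rtMain_sMinus (t : ℝ) {x : ℝ} (hx : x ≠ 0) (y : ℝ) {n : ℕ} (hn : 1 ≤ n) :
    rtMain t n (sMinus x y) =
      Mt t (sMinus x y) * (bCoeff t n : ℂ) *
        ((((n : ℝ) ^ y : ℝ) : ℂ) * (n : ℂ) ^ (-(conj (sStar t x y) + kappa t x y))) := by
  have hn0 : (n : ℂ) ≠ 0 := by exact_mod_cast (by omega : n ≠ 0)
  have he : -(sMinus x y + t / 2 * alpha (sMinus x y)) =
      (y : ℂ) + -(conj (sStar t x y) + kappa t x y) := by
    rw [conj_sStar_add_kappa t hx y]; ring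
  rw [rtMain, he, Complex.cpow_add _ _ hn0, Complex.ofReal_cpow (Nat.cast_nonneg n),
    Complex.ofReal_natCast]

/-- **`B_t f_t = A_{t,N} + B_{t,N}`**: `B_t(x+iy) f_t(x+iy) = Σ_{n≤N} (r-main_{t,n}(s₋) + (r-main_{t,n})^*(s₊))`.
[cite: Polymath2019, §6.3, eq. (ft-def) and Cor. 6.5] -/
theorem Bt_mul_ft (t : ℝ) {x : ℝ} (hx : x ≠ 0) (y : ℝ) :
    Bt t x y * ft t x y =
      ∑ n ∈ Finset.Icc 1 (rsN t x), (rtMain t n (sMinus x y) + refl (rtMain t n) (sPlus x y)) := by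
  have hB : Bt t x y ≠ 0 := Bt_ne_zero t hx y
  have hγ : Bt t x y * gamma t x y = Mt t (sMinus x y) := by
    rw [gamma, Bt]; exact mul_div_cancel₀ _ (by rwa [Bt] at hB)
  rw [ft, mul_add, ← mul_assoc, hγ, Finset.mul_sum, Finset.mul_sum, ← Finset.sum_add_distrib]
  refine Finset.sum_congr rfl fun n hn ↦ ?_
  have hn1 : 1 ≤ n := (Finset.mem_Icc.1 hn).1
  rw [refl_rtMain_sPlus t hx y n, rtMain_sMinus t hx y hn1, Complex.cpow_neg, Complex.cpow_neg]
  ring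

/-- `|r-main_{t,n}(s₋)| = |B_t| |γ| n^y b_n^t n^{−(Re s_* + Re κ)}`.
[cite: Polymath2019, §6.3, e_A] -/
theorem norm_rtMain_sMinus (t : ℝ) {x : ℝ} (hx : x ≠ 0) (y : ℝ) {n : ℕ} (hn : 1 ≤ n) :
    ‖rtMain t n (sMinus x y)‖ =
      ‖Bt t x y‖ * (‖gamma t x y‖ *
        ((n : ℝ) ^ y * bCoeff t n / (n : ℝ) ^ ((sStar t x y).re + (kappa t x y).re))) := by
  have hB : Bt t x y ≠ 0 := Bt_ne_zero t hx y
  have hnpos : 0 < n := by omega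
  have hnr : (0 : ℝ) < n := by exact_mod_cast hnpos
  have hγ : ‖Mt t (sMinus x y)‖ = ‖Bt t x y‖ * ‖gamma t x y‖ := by
    rw [← norm_mul, gamma, Bt, mul_div_cancel₀ _ (by rwa [Bt] at hB)]
  rw [rtMain_sMinus t hx y hn, norm_mul, norm_mul, norm_mul, hγ, Complex.norm_real, Complex.norm_real,
    Real.norm_of_nonneg (show 0 ≤ bCoeff t n from (Real.exp_pos _).le),
    Real.norm_of_nonneg (Real.rpow_nonneg hnr.le y),
    Complex.norm_natCast_cpow_of_pos hnpos, Complex.neg_re, Complex.add_re, Complex.conj_re,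
    Real.rpow_neg hnr.le]
  ring

/-- `|r-main_{t,n}(s̄₊)| = |B_t| b_n^t n^{−Re s_*}`. [cite: Polymath2019, §6.3, e_B] -/
theorem norm_rtMain_sPlusBar (t : ℝ) {x : ℝ} (hx : x ≠ 0) (y : ℝ) {n : ℕ} (hn : 1 ≤ n) :
    ‖rtMain t n ((1 + y + x * I) / 2)‖ = ‖Bt t x y‖ * (bCoeff t n / (n : ℝ) ^ (sStar t x y).re) := by
  have hnpos : 0 < n := by omega
  have hnr : (0 : ℝ) < n := by exact_mod_cast hnpos
  have h1 : ‖rtMain t n ((1 + y + x * I) / 2)‖ = ‖refl (rtMain t n) (sPlus x y)‖ := by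
    rw [refl, Complex.norm_conj, conj_sPlus]
  rw [h1, refl_rtMain_sPlus t hx y n, norm_mul, norm_mul, Complex.norm_real,
    Real.norm_of_nonneg (show 0 ≤ bCoeff t n from (Real.exp_pos _).le),
    Complex.norm_natCast_cpow_of_pos hnpos, Complex.neg_re, Real.rpow_neg hnr.le]
  ring

/-- **The `A+B` approximation, error form** (Cor. 6.5 divided by `B_t`, with Prop. 6.1 (E1) for the
`r_{t,n}` and Prop. 6.3♯ (E3♯, from E2) for `R_{t,N}`): in the region (1.6),
`|H_t(x+iy) − B_t f_t| ≤ |B_t| (e_A + e_B + e♯_{C,0})`. [cite: Polymath2019, Cor. 6.5 and §6.3] -/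
theorem norm_deBruijnH_sub_Bt_mul_ft_le (hA : arias_lehmer_rs_bound) (h : EffRegion t x y) :
    ‖deBruijnH t (x + y * I) - Bt t x y * ft t x y‖ ≤
      ‖Bt t x y‖ * (eA t x y + eB t x y + eC0Sharp t x y) := by
  obtain ⟨ht, ht', hy0, hy1, hx⟩ := h
  have hx0 : x ≠ 0 := by intro h; rw [h] at hx; norm_num at hx
  have hB : Bt t x y ≠ 0 := Bt_ne_zero t hx0 y
  have hBn : 0 < ‖Bt t x y‖ := norm_pos_iff.2 hB
  set N := rsN t x with hNdef
  -- E0 at `z = x + iy`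
  have hE0 := heat_rs_expansion t ht ((x : ℂ) + y * I) (by simp; exact hx0) N
  rw [half_one_add_I_mul, half_one_sub_I_mul] at hE0
  -- the difference
  have hdiff : deBruijnH t (x + y * I) - Bt t x y * ft t x y =
      (∑ n ∈ Finset.Icc 1 N, ((rt t n (sMinus x y) - rtMain t n (sMinus x y)) +
        (refl (rt t n) (sPlus x y) - refl (rtMain t n) (sPlus x y)))) +
      (Rt t N (sMinus x y) + refl (Rt t N) (sPlus x y)) := by
    rw [hE0, Bt_mul_ft t hx0 y, ← hNdef]
    simp only [Finset.sum_add_distrib, Finset.sum_sub_distrib]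
    ring
  -- E1 termwise
  have hT10 : 10 < x / 2 := by linarith
  have hterm : ∀ n ∈ Finset.Icc 1 N,
      ‖(rt t n (sMinus x y) - rtMain t n (sMinus x y)) +
        (refl (rt t n) (sPlus x y) - refl (rtMain t n) (sPlus x y))‖ ≤
      ‖Bt t x y‖ * (‖gamma t x y‖ *
        ((n : ℝ) ^ y * bCoeff t n / (n : ℝ) ^ ((sStar t x y).re + (kappa t x y).re) *
          epsTN t n (sMinus x y)) +
        bCoeff t n / (n : ℝ) ^ (sStar t x y).re * epsTN t n ((1 + y + x * I) / 2)) := by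
    intro n hn
    have hn1 : 1 ≤ n := (Finset.mem_Icc.1 hn).1
    have e1 := rtn_estimate t ((1 - y) / 2) (x / 2) n ht ht' hT10 hn1
    rw [← sMinus_eq] at e1
    have e2 := rtn_estimate t ((1 + y) / 2) (x / 2) n ht ht' hT10 hn1
    rw [← sPlusBar_eq] at e2
    have hrefl : refl (rt t n) (sPlus x y) - refl (rtMain t n) (sPlus x y) =
        conj (rt t n ((1 + y + x * I) / 2) - rtMain t n ((1 + y + x * I) / 2)) := by
      rw [refl, refl, ← map_sub, conj_sPlus]
    rw [hrefl]
    refine (norm_add_le _ _).trans ?_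
    rw [Complex.norm_conj, norm_rtMain_sMinus t hx0 y hn1] at *
    rw [norm_rtMain_sPlusBar t hx0 y hn1] at e2
    have := add_le_add e1 e2
    refine this.trans (le_of_eq ?_)
    ring
  have hsum := norm_sum_le_of_le (Finset.Icc 1 N) hterm
  have hAB' : ∑ n ∈ Finset.Icc 1 N, ‖Bt t x y‖ * (‖gamma t x y‖ *
        ((n : ℝ) ^ y * bCoeff t n / (n : ℝ) ^ ((sStar t x y).re + (kappa t x y).re) *
          epsTN t n (sMinus x y)) +
        bCoeff t n / (n : ℝ) ^ (sStar t x y).re * epsTN t n ((1 + y + x * I) / 2)) =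
      ‖Bt t x y‖ * (eA t x y + eB t x y) := by
    rw [eA, eB, ← hNdef, Finset.mul_sum, ← Finset.sum_add_distrib, Finset.mul_sum]
  rw [hAB'] at hsum
  -- E3♯ for the two remainders
  have hNa : ⌊rsA t (x / 2)⌋₊ = N := by rw [hNdef, rsN, rsA_half]
  have hR1 := RtN_bound_sharp hA t ((1 - y) / 2) (x / 2) ht ht' (by linarith) (by linarith)
    (by linarith)
  rw [hNa, ← sMinus_eq] at hR1
  have hR2 := RtN_bound_sharp hA t ((1 + y) / 2) (x / 2) ht ht' (by linarith) (by linarith)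
    (by linarith)
  rw [hNa, ← sPlusBar_eq] at hR2
  have hR2' : ‖refl (Rt t N) (sPlus x y)‖ ≤
      Real.exp (t * π ^ 2 / 64) * ‖M₀ (I * (x / 2 + π * t / 8 : ℝ))‖ *
        (1 / 2 + epsSharp t ((1 + y) / 2) (x / 2)) := by
    rw [refl, Complex.norm_conj, conj_sPlus]; exact hR2
  have hC : ‖Rt t N (sMinus x y) + refl (Rt t N) (sPlus x y)‖ ≤ ‖Bt t x y‖ * eC0Sharp t x y := by
    refine (norm_add_le _ _).trans ?_
    rw [eC0Sharp, show ‖Bt t x y‖ * (Real.exp (t * π ^ 2 / 64) * ‖M₀ (I * (x / 2 + π * t / 8 : ℝ))‖ /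
        ‖Bt t x y‖ * (1 + epsSharp t ((1 - y) / 2) (x / 2) + epsSharp t ((1 + y) / 2) (x / 2))) =
        Real.exp (t * π ^ 2 / 64) * ‖M₀ (I * (x / 2 + π * t / 8 : ℝ))‖ *
          (1 / 2 + epsSharp t ((1 - y) / 2) (x / 2)) +
        Real.exp (t * π ^ 2 / 64) * ‖M₀ (I * (x / 2 + π * t / 8 : ℝ))‖ *
          (1 / 2 + epsSharp t ((1 + y) / 2) (x / 2)) by field_simp; ring]
    exact add_le_add hR1 hR2'
  rw [hdiff]
  refine (norm_add_le _ _).trans ?_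
  have := add_le_add hsum hC
  refine this.trans (le_of_eq ?_)
  ring

/-- **Polymath 15, Thm. 1.3, modulo Prop. 6.2** (THEORY-R6 item E4): the named fact
`Polymath15.effective_approximation` follows from the named fact `arias_lehmer_rs_bound`
(Arias de Reyna 2011, Thms. 3.1/4.1/4.2 = the source's Prop. 6.2) via the heat-flowed Riemann–Siegel
expansion (E0), Prop. 6.1 (E1), Prop. 6.3 with corrected constants (E3♯), Prop. 6.6 (iv)–(v) (E4a)
and Prop. 6.6 (vi) for the corrected `ε̃♯` (E4a♯): in the region (1.6),
`‖H_t(x+iy)/B_t(x+iy) − f_t(x+iy)‖ ≤ e_A + e_B + e♯_{C,0} ≤ errAB + errC0`.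
[cite: Polymath2019, Thm. 1.3 and §6.3] -/
theorem effective_approximation_of_arias (hA : arias_lehmer_rs_bound) : effective_approximation := by
  intro t x y h
  have hmain := norm_deBruijnH_sub_Bt_mul_ft_le hA h
  have hAB := eA_add_eB_le_errAB h
  have hC0 := eC0Sharp_le_errC0 h
  obtain ⟨ht, ht', hy0, hy1, hx⟩ := h
  have hx0 : x ≠ 0 := by intro e; rw [e] at hx; norm_num at hx
  have hB : Bt t x y ≠ 0 := Bt_ne_zero t hx0 y
  have hBn : 0 < ‖Bt t x y‖ := norm_pos_iff.2 hB
  have he : deBruijnH t (x + y * I) / Bt t x y - ft t x y =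
      (deBruijnH t (x + y * I) - Bt t x y * ft t x y) / Bt t x y := by
    field_simp
  rw [he, norm_div, div_le_iff₀ hBn]
  calc ‖deBruijnH t (x + y * I) - Bt t x y * ft t x y‖
      ≤ ‖Bt t x y‖ * (eA t x y + eB t x y + eC0Sharp t x y) := hmain
    _ ≤ (errAB t x y + errC0 t x y) * ‖Bt t x y‖ := by
        rw [mul_comm]; exact mul_le_mul_of_nonneg_right (by linarith) hBn.le

end Combination

end Polymath15

end Literature.NumberTheory.LFunctions

end
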